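import Literature.MathematicalPhysics.QuantumFieldTheory.Balaban1983to89.B2Eq246ScalarStep

/-!
# `Balaban1983to89.B2Eq246PairStep` — T. Bałaban, *(Higgs)₂,₃ quantum fields in a finite volume. II. An upper bound*,
Commun. Math. Phys. **86** (1982) 555–594 [Balaban1982Higgs2] p. 567: **(2.45) → (2.46) FOR BOTH FIELD SPECIES AT ONCE** —
the printed double conditional integration `χ_k∫dA′↾_{Λ₅ᶜ}∫dφ′↾_{Λ₅ᶜ} t_{a,L}(Λ₅ᶜ; A, A′) t_{a,L,Ã}(Λ₅ᶜ; φ, φ′) ⋯ Z_{Λ₅}Z_{Λ₅}(Ω, A)`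
of the `k`-th step ON THE CONCRETE (Higgs)₂,₃ CARRIER, with a weight depending JOINTLY on the two exterior fields (as
`ζχχρ′` does): p15's two-species model theorem `B2Eq234SecondRepr.secondRepr_pair` instantiated with the typer's letters of
`B2Eq246ScalarStep` for the vector species (`N = d`, coupling `U ≡ 1`, external field `0`, whole torus, mass `μ₀²` — I p. 608
*"N = d and an external vector field A = 0"*) and for the scalar species (`C`, `Ω`, `A`, `m²`)

statement-level skeleton of published theorems with citation tags; proofs where landed; nothing here is a claim about the Yang–Mills mass gap

PDFs held: `paper:balaban1982-cmp86-higgs23-ii` (journal page = PDF page + 554), p. 567 [PDF 13]; `paper:balaban1982-cmp85-higgs23-i`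
(journal page = PDF page + 602), p. 608 [PDF 6] — read AS IMAGES on the ×2 renders
`run/shared/lean/pub/pub-balaban/b2b-balaban-ref1/pages/1982-cmp86-higgs23-II/1982-cmp86-higgs23-II-p013-x2.png`,
`…/1982-cmp85-higgs23-I/1982-cmp85-higgs23-I-p006-x2.png`.

CITATION HEADER (lean-in-tree rule).  lit-balaban typed skeleton (HOME `run/shared/lean/pub/lit-balaban/`), typer line
(concrete carriers), gen 5, file C of the (2.45)→(2.46) set (A `B2Eq227CondDelta` (2.27); B `B2Eq246ScalarStep` one species).
SKELETON row served: **B2.Eq2.44** members (2.45)/(2.46) (the typer cells; fold owner r02, second reader r14).  NOTHING of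
record is restated: the identity IS p15's `secondRepr_pair`; every letter and dictionary lemma is file B's
(`kerQ`, `matD`, `mainOp_eq_formMat`, `kerQ_support`, `firstExp_eq_stepExp245`, `secondExp_eq_stepExp246`,
`norm_integrand_eq`, `fieldOfOut`, `rtKernelStep_eq`, `rtKernelOut_eq`, `zCond252`); the vector-field objects at the trivial
coupling ARE the typer's `HiggsFluctMeasure.precOp`/`deltaK` (p35's `precOpA_zero_field`, `deltaKA_zero_field`).
THE SOURCE TEXT, p. 567 [PDF 13], verbatim: *"Another representation is obtained by calculation of a conditional integral
in (2.45) with the conditioning on Λ₅^{(k−1)c}: ρ″^{(k),L^kε}(Λ₀^{(0)}, …, Λ₀^{(k−1)}, A, θ_kA^{(k),ε}, φ)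
= χ_k∫dA′↾_{Λ₅^{(k−1)c}}∫dφ′↾_{Λ₅^{(k−1)c}} t^{L^{k−1}ε}_{a,L}(Λ₅^{(k−1)c}; A, A′) t^{L^{k−1}ε}_{a,L,Ã}(Λ₅^{(k−1)c}; φ, φ′)
· ζ_{Λ₀^{(k−1)}}χ_{Λ₋₁^{(k−1)}∩Λ₅^{(k−1)c}}χ_{k−1,Λ₅^{(k−1)c}} ρ′^{(k−1),L^{k−1}ε}(Λ₀^{(0)}, …, Λ₀^{(k−2)}, A′, Ã′, φ′)
· exp[−½⟨(Λ₆^{(k−2)′}∩Λ₅^{(k−1)c})A′, Δ^{(k−1),L^{k−1}ε}(Λ₆^{(k−2)′}∩Λ₅^{(k−1)c})A′⟩ + ½⟨(Λ₆^{(k−2)′}∩Λ₅^{(k−1)c})A′,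
Δ^{(k−1),L^{k−1}ε}C^{(k−1),L^{k−1}ε}_{Λ₅^{(k−1)}}Δ^{(k−1),L^{k−1}ε}(Λ₆^{(k−2)′}∩Λ₅^{(k−1)c})A′⟩ − a(L^kε)^{−2}⟨(Λ₆^{(k−2)′}∩Λ₅^{(k−1)c})A′,
Δ^{(k−1),L^{k−1}ε}C^{(k−1),L^{k−1}ε}_{Λ₅^{(k−1)}}Q^*A⟩ − ½⟨A, Δ^{(k),L^kε}_{Λ₅^{(k−1)}}A⟩ − … (scalar-field terms 5–10) …]
· Z^{(k−1),L^{k−1}ε}_{Λ₅^{(k−1)}} Z^{(k−1),L^{k−1}ε}_{Λ₅^{(k−1)}}(B^{k−1}(Λ₂^{(k−1)}), A^{(k),ε}). (2.46)"*; p. 568: *"and similarly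
for the form ⟨A, Δ^{(k),L^kε}_{Λ₅^{(k−1)}}A⟩, except that Neumann boundary conditions are not introduced"*.

WHAT THIS FILE PROVES (0 sorry; standard axioms; theorems only).
 * `measurable_fieldOfOut₂` — the joint weight `(y, y′) ↦ G(fieldOfOut y, fieldOfOut y′)` is jointly measurable for jointly
   measurable `G`.
 * **`condStep246_pair`** — for m² > 0, μ₀² > 0, a > 0, L > 1, `j ≤ K`, every `Ω`, `A`, `C`, `Λ′` (`Λ = B(Λ′)`), new fields
   `B` (vector, `d` components) and `ψ` (scalar), and every bounded jointly measurable weight `G(ΛᶜA′, Λᶜφ′)`: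
   `∫dA′∫dφ′ G · e^{stepExp245_vec(B,A′)} e^{stepExp245(ψ,φ′)}
    = ∫dA′↾_{Λᶜ}∫dφ′↾_{Λᶜ} G · e^{stepExp246_vec} e^{stepExp246} · ∫dA′↾_Λ e^{−½⟨A′,(C^{(j)}_Λ)^{−1}A′⟩} · ∫dφ′↾_Λ e^{−½⟨φ′,(C^{(j)}_Λ(Ω,A))^{−1}φ′⟩}`
   (the vector species = file B's letters at `N = d`, `C = zeroCharge`, `A = 0`, `Ω = T`, mass `μ₀²`).
 * **`rt_condStep_pair`** — the same in the kernel form of the print: `∫dA′∫dφ′ t_{a,L}(B,A′) t_{a,L,A}(ψ,φ′) e^{−½⟨A′,Δ^{(j)}A′⟩}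
   e^{−½⟨φ′,Δ^{(j)}(Ω,A)φ′⟩} G = ∫dA′↾_{Λᶜ}∫dφ′↾_{Λᶜ} t(Λᶜ;B,A′) t(Λᶜ;ψ,φ′) e^{terms 1–4} e^{terms 7–10} G · Z^{(j)}_Λ · Z^{(j)}_Λ(Ω,A)`.
 * `precOpA_vec`, `deltaKA_vec`, `stepExp245_vec`, `zCond252_vec`: the vector-species operators / exponent / `Z` ARE the typer's
   `HiggsFluctMeasure.precOp`/`deltaK` letters (p35's `precOpA_zero_field`, `deltaKA_zero_field`, by name).
HONEST SCOPE as in file B: basic forms on all of `T^{(j)}` (print: `Λ₆^{(k−2)′}` for `A′`, `Λ₃^{(k−1)}` for `φ′` — identical on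
`Λ₅`); regions, cut-offs, characteristic functions, `ρ′`, `χ_k` = the weight `G` (resp. constant factors); vector field in
components on sites (`toSite` of the typer's bond fields); nothing quantitative.  Value = the literal two-species shape of
(2.46) certified for the concrete objects; NOT summit progress.  Unit `lit-balaban-typer` gen 5
(literature-prover-lit-balaban-typer-g5-0); HOME/FILED.md records the proposal.
-/

open scoped BigOperators InnerProductSpace Matrix
open _root_.MeasureTheory Matrix

namespace Literature.MathematicalPhysics.QuantumFieldTheory.Balaban1983to89.B2Eq246PairStep

open HiggsLattice HiggsAveraging HiggsCovariance B1Eq27StepAdjoint B1Eq221Coordinates B1Eq230FluctCov B1Eq230FluctCovPos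
  HiggsCondCov232 HiggsCondGauss228 B2Eq255Concrete B2Eq227CondDelta B2Eq246ScalarStep
open B2Eq228Conditioning (In Out resIn resOut glue blkIn blkMix blkOut)
open B2Eq234Exponent (mainOp firstExp secondExp)
open B3MultiscaleFields (zeroCharge)

variable {P : HiggsLattice.Params} {N : ℕ}

/-! ## §1 The vector species: file B's letters at the trivial coupling -/

/-- The vector-species operator of I (2.30) at `N = d`, `U ≡ 1`, external field `0`, whole torus IS the typer's
`HiggsFluctMeasure.precOp` (p35's `precOpA_zero_field`, restated for the mass letter `μ₀²`). [cite: Balaban1982Higgs1, (2.30) p.611] -/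
theorem precOpA_vec (μ a : ℝ) (j : ℕ) :
    precOpA (zeroCharge P.d) Finset.univ (0 : HiggsLattice.VecField P 0) μ a j = HiggsFluctMeasure.precOp P μ a j :=
  precOpA_zero_field μ a j

/-- … and its basic form `Δ^{(j),L^jε}` IS the typer's `HiggsFluctMeasure.deltaK`. [cite: Balaban1982Higgs1, (2.21) p.610] -/
theorem deltaKA_vec (μ a : ℝ) (j : ℕ) :
    deltaKA (zeroCharge P.d) Finset.univ (0 : HiggsLattice.VecField P 0) μ a j = HiggsFluctMeasure.deltaK P μ a j :=
  deltaKA_zero_field μ a j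

/-- The vector-species first exponent: `−½a(L^{j+1}ε)^{−2}‖B − QA′‖² − ½⟨A′, Δ^{(j)}A′⟩` with the typer's `deltaK`.
[cite: Balaban1982Higgs2, (2.45) p.567] -/
theorem stepExp245_vec (μ a : ℝ) (j : ℕ) (Bn : ScalarField P (j + 1) P.d) (B : ScalarField P j P.d) :
    stepExp245 (zeroCharge P.d) Finset.univ (0 : HiggsLattice.VecField P 0) μ a j Bn B
      = -(1 / 2 : ℝ) * stepCoef P a j
            * siteInner (Bn - avgQLin (zeroCharge P.d) (0 : HiggsLattice.VecField P 0) j B)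
                (Bn - avgQLin (zeroCharge P.d) (0 : HiggsLattice.VecField P 0) j B)
          - (1 / 2 : ℝ) * siteInner B (HiggsFluctMeasure.deltaK P μ a j B) := by
  rw [stepExp245, deltaKA_vec]

/-- The vector-species normalisation factor `Z^{(j),L^jε}_Λ` of (2.52) (no field arguments): file B's `zCond252` at the trivial
coupling, its integrand read through the typer's `precOp`. [cite: Balaban1982Higgs2, (2.52) p.569] -/
theorem zCond252_vec (μ a : ℝ) (j : ℕ) (Λ' : Finset (HiggsLattice.Site P (j + 1))) :
    zCond252 (zeroCharge P.d) Finset.univ (0 : HiggsLattice.VecField P 0) μ a j Λ'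
      = (B1RT.prec a (P.mesh (j + 1)) P.d / (2 * Real.pi)) ^ ((P.d : ℝ) / 2 * (Λ'.card : ℝ))
          * ∫ x : In (inSet (P := P) P.d (blockSet Λ')) → ℝ,
              Real.exp (-(1 / 2 : ℝ) * siteInner (fieldOfCrd (blockSet Λ') x)
                (HiggsFluctMeasure.precOp P μ a j (fieldOfCrd (blockSet Λ') x))) := by
  rw [zCond252, precOpA_vec]

/-- The joint weight `(A′↾_{Λᶜ}, φ′↾_{Λᶜ}) ↦ G` of the (2.46) integral, in exterior coordinates, is jointly measurable for jointly
measurable `G`. [cite: Balaban1982Higgs2, (2.46) p.567] -/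
theorem measurable_fieldOfOut₂ {j : ℕ} (Λ : Finset (HiggsLattice.Site P j)) {M : ℕ}
    {G : ScalarField P j M → ScalarField P j N → ℝ} (hG : Measurable (Function.uncurry G)) :
    Measurable (Function.uncurry fun (y : Out (inSet (P := P) M Λ) → ℝ) (y' : Out (inSet (P := P) N Λ) → ℝ) =>
      G (fieldOfOut Λ y) (fieldOfOut Λ y')) := by
  have h : (Function.uncurry fun (y : Out (inSet (P := P) M Λ) → ℝ) (y' : Out (inSet (P := P) N Λ) → ℝ) =>
        G (fieldOfOut Λ y) (fieldOfOut Λ y'))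
      = Function.uncurry G ∘ Prod.map (fieldOfOut (N := M) Λ) (fieldOfOut (N := N) Λ) := by
    funext q
    rfl
  rw [h]
  exact hG.comp ((measurable_fieldOfOut Λ).prodMap (measurable_fieldOfOut Λ))

/-! ## §2 (2.45) → (2.46) for both species -/

section Pair

variable (C : ChargeData N) (Ω : Finset (HiggsLattice.Site P 0)) (A : HiggsLattice.VecField P 0) (msq μ a : ℝ)

/-- **(2.45) → (2.46), BOTH SPECIES, ON THE CONCRETE CARRIER**: for m² > 0, μ₀² > 0, a > 0, L > 1, `j ≤ K`, every `Ω`, `A`,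
`C`, every `Λ′` (`Λ = B(Λ′)`), new fields `B` (vector) and `ψ` (scalar), and every bounded jointly measurable weight
`G(ΛᶜA′, Λᶜφ′)` (↤ `ζχχρ′·e^{other terms}`, a function of BOTH exterior fields):
`∫dA′∫dφ′ G(ΛᶜA′,Λᶜφ′) e^{stepExp245_vec(B,A′)} e^{stepExp245(ψ,φ′)}
 = ∫dA′↾_{Λᶜ}∫dφ′↾_{Λᶜ} G e^{stepExp246_vec(B,·)} e^{stepExp246(ψ,·)} · (∫dA′↾_Λ e^{−½⟨A′,(precOp)A′⟩} · ∫dφ′↾_Λ e^{−½⟨φ′,(precOpA)φ′⟩})`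
— p15's `secondRepr_pair` with every hypothesis discharged by file B's dictionary, vector species = the letters at
`(zeroCharge, T, 0, μ₀²)`. [cite: Balaban1982Higgs2, (2.46) p.567] -/
theorem condStep246_pair {msq μ a : ℝ} (hmsq : 0 < msq) (hμ : 0 < μ) (ha : 0 < a) (hL : 1 < (P.L : ℝ)) {j : ℕ} (hj : j ≤ P.K)
    (Λ' : Finset (HiggsLattice.Site P (j + 1))) {G : ScalarField P j P.d → ScalarField P j N → ℝ}
    (hG : Measurable (Function.uncurry G)) {CG : ℝ} (hGb : ∀ B φ, |G B φ| ≤ CG)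
    (Bn : ScalarField P (j + 1) P.d) (ψ : ScalarField P (j + 1) N) :
    ∫ B : ScalarField P j P.d, ∫ φ : ScalarField P j N,
        G (cutTo (blockSet Λ')ᶜ B) (cutTo (blockSet Λ')ᶜ φ)
          * (Real.exp (stepExp245 (zeroCharge P.d) Finset.univ 0 μ a j Bn B) * Real.exp (stepExp245 C Ω A msq a j ψ φ))
      = (∫ y : Out (inSet (P := P) P.d (blockSet Λ')) → ℝ, ∫ y' : Out (inSet (P := P) N (blockSet Λ')) → ℝ,
            G (fieldOfOut (blockSet Λ') y) (fieldOfOut (blockSet Λ') y')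
              * (Real.exp (stepExp246 (zeroCharge P.d) Finset.univ 0 μ a j Λ' Bn (fieldOfOut (blockSet Λ') y))
                  * Real.exp (stepExp246 C Ω A msq a j Λ' ψ (fieldOfOut (blockSet Λ') y'))))
        * ((∫ x : In (inSet (P := P) P.d (blockSet Λ')) → ℝ,
              Real.exp (-(1 / 2 : ℝ) * siteInner (fieldOfCrd (blockSet Λ') x)
                (precOpA (zeroCharge P.d) Finset.univ 0 μ a j (fieldOfCrd (blockSet Λ') x))))
            * ∫ x : In (inSet (P := P) N (blockSet Λ')) → ℝ,
              Real.exp (-(1 / 2 : ℝ) * siteInner (fieldOfCrd (blockSet Λ') x)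
                (precOpA C Ω A msq a j (fieldOfCrd (blockSet Λ') x)))) := by
  -- the letters of the two species
  have hA : (mainOp (B1RT.prec a (P.mesh (j + 1)) P.d) (kerQ (zeroCharge P.d) (0 : HiggsLattice.VecField P 0) j)
      (matD (zeroCharge P.d) (0 : HiggsLattice.VecField P 0) Finset.univ μ a j)).PosDef := by
    rw [mainOp_eq_formMat]
    exact formMat_posDef (zeroCharge P.d) Finset.univ 0 hμ ha hL hj
  have hA' : (mainOp (B1RT.prec a (P.mesh (j + 1)) P.d) (kerQ C A j) (matD C A Ω msq a j)).PosDef := by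
    rw [mainOp_eq_formMat]
    exact formMat_posDef C Ω A hmsq ha hL hj
  have hQ : ∀ s t, kerQ (zeroCharge P.d) (0 : HiggsLattice.VecField P 0) j s t ≠ 0 → (inSet P.d (blockSet Λ') s ↔ inSet P.d Λ' t) :=
    fun s t h => kerQ_support (zeroCharge P.d) 0 j Λ' s t h
  have hQ' : ∀ s t, kerQ C A j s t ≠ 0 → (inSet N (blockSet Λ') s ↔ inSet N Λ' t) :=
    fun s t h => kerQ_support C A j Λ' s t h
  have hst : ∀ i o, (i, o) ∉ (Finset.univ : Finset (In (inSet (P := P) P.d (blockSet Λ')) × Out (inSet (P := P) P.d (blockSet Λ'))))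
      → blkMix (inSet P.d (blockSet Λ')) (matD (zeroCharge P.d) (0 : HiggsLattice.VecField P 0) Finset.univ μ a j) i o = 0 :=
    fun i o h => absurd (Finset.mem_univ _) h
  have hst' : ∀ i o, (i, o) ∉ (Finset.univ : Finset (In (inSet (P := P) N (blockSet Λ')) × Out (inSet (P := P) N (blockSet Λ'))))
      → blkMix (inSet N (blockSet Λ')) (matD C A Ω msq a j) i o = 0 := fun i o h => absurd (Finset.mem_univ _) h
  have hG₀ := measurable_fieldOfOut₂ (blockSet Λ') hG
  have hG₀b : ∀ (y : Out (inSet (P := P) P.d (blockSet Λ')) → ℝ) (y' : Out (inSet (P := P) N (blockSet Λ')) → ℝ),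
      |G (fieldOfOut (blockSet Λ') y) (fieldOfOut (blockSet Λ') y')| ≤ CG := fun y y' => hGb _ _
  have key := B2Eq234SecondRepr.secondRepr_pair (inSet P.d (blockSet Λ')) (inSet P.d Λ') (inSet N (blockSet Λ')) (inSet N Λ')
    (B1RT.prec a (P.mesh (j + 1)) P.d) (kerQ (zeroCharge P.d) (0 : HiggsLattice.VecField P 0) j)
    (matD (zeroCharge P.d) (0 : HiggsLattice.VecField P 0) Finset.univ μ a j) hA hQ Finset.univ hst
    (B1RT.prec a (P.mesh (j + 1)) P.d) (kerQ C A j) (matD C A Ω msq a j) hA' hQ' Finset.univ hst' hG₀ hG₀b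
    (fieldCoord (E P.d) (HiggsLattice.Site P (j + 1)) Bn) (fieldCoord (E N) (HiggsLattice.Site P (j + 1)) ψ)
  -- the left side in coordinates
  have hLHS : (∫ B : ScalarField P j P.d, ∫ φ : ScalarField P j N,
        G (cutTo (blockSet Λ')ᶜ B) (cutTo (blockSet Λ')ᶜ φ)
          * (Real.exp (stepExp245 (zeroCharge P.d) Finset.univ 0 μ a j Bn B) * Real.exp (stepExp245 C Ω A msq a j ψ φ)))
      = ∫ z : HiggsLattice.Site P j × Ix P.d → ℝ, ∫ z' : HiggsLattice.Site P j × Ix N → ℝ,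
          G (fieldOfOut (blockSet Λ') (resOut (inSet P.d (blockSet Λ')) z)) (fieldOfOut (blockSet Λ') (resOut (inSet N (blockSet Λ')) z'))
            * (Real.exp (firstExp (B1RT.prec a (P.mesh (j + 1)) P.d) (kerQ (zeroCharge P.d) (0 : HiggsLattice.VecField P 0) j)
                  (matD (zeroCharge P.d) (0 : HiggsLattice.VecField P 0) Finset.univ μ a j)
                  (fieldCoord (E P.d) (HiggsLattice.Site P (j + 1)) Bn) z)
               * Real.exp (firstExp (B1RT.prec a (P.mesh (j + 1)) P.d) (kerQ C A j) (matD C A Ω msq a j)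
                  (fieldCoord (E N) (HiggsLattice.Site P (j + 1)) ψ) z')) := by
    rw [integral_comp_fieldCoord (E P.d) (HiggsLattice.Site P j)]
    refine integral_congr_ae (Filter.Eventually.of_forall fun z => ?_)
    beta_reduce
    rw [integral_comp_fieldCoord (E N) (HiggsLattice.Site P j)]
    refine integral_congr_ae (Filter.Eventually.of_forall fun z' => ?_)
    beta_reduce
    rw [← firstExp_eq_stepExp245, ← firstExp_eq_stepExp245, LinearEquiv.apply_symm_apply, LinearEquiv.apply_symm_apply,
      ← fieldOfOut_resOut (blockSet Λ') ((fieldCoord (E P.d) (HiggsLattice.Site P j)).symm z),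
      ← fieldOfOut_resOut (blockSet Λ') ((fieldCoord (E N) (HiggsLattice.Site P j)).symm z'),
      LinearEquiv.apply_symm_apply, LinearEquiv.apply_symm_apply]
  rw [hLHS, key]
  congr 1
  · refine integral_congr_ae (Filter.Eventually.of_forall fun y => ?_)
    beta_reduce
    refine integral_congr_ae (Filter.Eventually.of_forall fun y' => ?_)
    beta_reduce
    rw [secondExp_eq_stepExp246 (zeroCharge P.d) Finset.univ 0 j hμ ha hL hj, secondExp_eq_stepExp246 C Ω A j hmsq ha hL hj]
  · congr 1
    · refine integral_congr_ae (Filter.Eventually.of_forall fun x => ?_)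
      beta_reduce
      rw [mainOp_eq_formMat, norm_integrand_eq]
    · refine integral_congr_ae (Filter.Eventually.of_forall fun x => ?_)
      beta_reduce
      rw [mainOp_eq_formMat, norm_integrand_eq]

/-- **(2.45) → (2.46), BOTH SPECIES, IN THE KERNEL FORM OF THE PRINT**:
`∫dA′∫dφ′ t_{a,L}(B, A′) t_{a,L,A}(ψ, φ′) e^{−½⟨A′, Δ^{(j)}A′⟩} e^{−½⟨φ′, Δ^{(j)}(Ω,A)φ′⟩} G(ΛᶜA′, Λᶜφ′)
 = ∫dA′↾_{Λᶜ}∫dφ′↾_{Λᶜ} t(Λᶜ; B, A′) t(Λᶜ; ψ, φ′) · e^{terms 1–4} e^{terms 7–10} · G · Z^{(j)}_Λ · Z^{(j)}_Λ(Ω, A)`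
(`rtKernelStep`/`rtKernelOut` at the trivial coupling ↤ `t_{a,L}`/`t_{a,L}(Λ₅ᶜ;·,·)`, at `(C, A)` ↤ `t_{a,L,Ã}`; `condTerms246` at the
trivial coupling ↤ terms 1–4, at `(C, Ω, A)` ↤ terms 7–10; `zCond252` at the trivial coupling ↤ `Z^{(k−1)}_{Λ₅}`, at `(C, Ω, A)` ↤
`Z^{(k−1)}_{Λ₅}(B^{k−1}(Λ₂), A^{(k),ε})`). [cite: Balaban1982Higgs2, (2.46) p.567] -/
theorem rt_condStep_pair {msq μ a : ℝ} (hmsq : 0 < msq) (hμ : 0 < μ) (ha : 0 < a) (hL : 1 < (P.L : ℝ)) {j : ℕ} (hj : j ≤ P.K)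
    (Λ' : Finset (HiggsLattice.Site P (j + 1))) {G : ScalarField P j P.d → ScalarField P j N → ℝ}
    (hG : Measurable (Function.uncurry G)) {CG : ℝ} (hGb : ∀ B φ, |G B φ| ≤ CG)
    (Bn : ScalarField P (j + 1) P.d) (ψ : ScalarField P (j + 1) N) :
    ∫ B : ScalarField P j P.d, ∫ φ : ScalarField P j N,
        rtKernelStep (zeroCharge P.d) a 0 Bn B * rtKernelStep C a A ψ φ
          * (Real.exp (-(1 / 2 : ℝ) * siteInner B (deltaKA (zeroCharge P.d) Finset.univ 0 μ a j B))
              * Real.exp (-(1 / 2 : ℝ) * siteInner φ (deltaKA C Ω A msq a j φ))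
              * G (cutTo (blockSet Λ')ᶜ B) (cutTo (blockSet Λ')ᶜ φ))
      = (∫ y : Out (inSet (P := P) P.d (blockSet Λ')) → ℝ, ∫ y' : Out (inSet (P := P) N (blockSet Λ')) → ℝ,
            rtKernelOut (zeroCharge P.d) 0 a j Λ' Bn (fieldOfOut (blockSet Λ') y)
              * rtKernelOut C A a j Λ' ψ (fieldOfOut (blockSet Λ') y')
              * (Real.exp (condTerms246 (zeroCharge P.d) Finset.univ 0 μ a j Λ' Bn (fieldOfOut (blockSet Λ') y))
                  * Real.exp (condTerms246 C Ω A msq a j Λ' ψ (fieldOfOut (blockSet Λ') y'))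
                  * G (fieldOfOut (blockSet Λ') y) (fieldOfOut (blockSet Λ') y')))
        * (zCond252 (zeroCharge P.d) Finset.univ 0 μ a j Λ' * zCond252 C Ω A msq a j Λ') := by
  set c : ℝ := B1RT.prec a (P.mesh (j + 1)) P.d / (2 * Real.pi) with hc_def
  have hprec : 0 < B1RT.prec a (P.mesh (j + 1)) P.d := B1RT.prec_pos ha (P.mesh_pos _) P.d
  have hc : 0 < c := by rw [hc_def]; positivity
  have hcard : ((Λ'ᶜ.card : ℕ) : ℝ) + (Λ'.card : ℝ) = (Fintype.card (HiggsLattice.Site P (j + 1)) : ℝ) := by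
    rw [Finset.card_compl]
    have hle : Λ'.card ≤ Fintype.card (HiggsLattice.Site P (j + 1)) := Finset.card_le_univ _
    push_cast [Nat.cast_sub hle]
    ring
  set eT : ℝ := (N : ℝ) / 2 * (Fintype.card (HiggsLattice.Site P (j + 1)) : ℝ) with heT
  set eTd : ℝ := (P.d : ℝ) / 2 * (Fintype.card (HiggsLattice.Site P (j + 1)) : ℝ) with heTd
  -- left side
  have hL1 : (∫ B : ScalarField P j P.d, ∫ φ : ScalarField P j N,
        rtKernelStep (zeroCharge P.d) a 0 Bn B * rtKernelStep C a A ψ φ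
          * (Real.exp (-(1 / 2 : ℝ) * siteInner B (deltaKA (zeroCharge P.d) Finset.univ 0 μ a j B))
              * Real.exp (-(1 / 2 : ℝ) * siteInner φ (deltaKA C Ω A msq a j φ))
              * G (cutTo (blockSet Λ')ᶜ B) (cutTo (blockSet Λ')ᶜ φ)))
      = c ^ eTd * c ^ eT
          * ∫ B : ScalarField P j P.d, ∫ φ : ScalarField P j N,
              G (cutTo (blockSet Λ')ᶜ B) (cutTo (blockSet Λ')ᶜ φ)
                * (Real.exp (stepExp245 (zeroCharge P.d) Finset.univ 0 μ a j Bn B)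
                    * Real.exp (stepExp245 C Ω A msq a j ψ φ)) := by
    rw [← integral_const_mul]
    refine integral_congr_ae (Filter.Eventually.of_forall fun B => ?_)
    beta_reduce
    rw [← integral_const_mul]
    refine integral_congr_ae (Filter.Eventually.of_forall fun φ => ?_)
    beta_reduce
    rw [rtKernelStep_eq (zeroCharge P.d) 0 j Bn B ha, rtKernelStep_eq C A j ψ φ ha, exp_stepExp245, exp_stepExp245,
      ← hc_def, ← heT, ← heTd]
    ring
  -- right side
  have hR1 : (∫ y : Out (inSet (P := P) P.d (blockSet Λ')) → ℝ, ∫ y' : Out (inSet (P := P) N (blockSet Λ')) → ℝ,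
        rtKernelOut (zeroCharge P.d) 0 a j Λ' Bn (fieldOfOut (blockSet Λ') y)
          * rtKernelOut C A a j Λ' ψ (fieldOfOut (blockSet Λ') y')
          * (Real.exp (condTerms246 (zeroCharge P.d) Finset.univ 0 μ a j Λ' Bn (fieldOfOut (blockSet Λ') y))
              * Real.exp (condTerms246 C Ω A msq a j Λ' ψ (fieldOfOut (blockSet Λ') y'))
              * G (fieldOfOut (blockSet Λ') y) (fieldOfOut (blockSet Λ') y')))
      = c ^ ((P.d : ℝ) / 2 * (Λ'ᶜ.card : ℝ)) * c ^ ((N : ℝ) / 2 * (Λ'ᶜ.card : ℝ))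
          * ∫ y : Out (inSet (P := P) P.d (blockSet Λ')) → ℝ, ∫ y' : Out (inSet (P := P) N (blockSet Λ')) → ℝ,
              G (fieldOfOut (blockSet Λ') y) (fieldOfOut (blockSet Λ') y')
                * (Real.exp (stepExp246 (zeroCharge P.d) Finset.univ 0 μ a j Λ' Bn (fieldOfOut (blockSet Λ') y))
                    * Real.exp (stepExp246 C Ω A msq a j Λ' ψ (fieldOfOut (blockSet Λ') y'))) := by
    rw [← integral_const_mul]
    refine integral_congr_ae (Filter.Eventually.of_forall fun y => ?_)
    beta_reduce
    rw [← integral_const_mul]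
    refine integral_congr_ae (Filter.Eventually.of_forall fun y' => ?_)
    beta_reduce
    rw [rtKernelOut_eq (zeroCharge P.d) 0 j Λ' Bn (cutTo_compl_fieldOfOut (blockSet Λ') y) ha,
      rtKernelOut_eq C A j Λ' ψ (cutTo_compl_fieldOfOut (blockSet Λ') y') ha, exp_stepExp246, exp_stepExp246, ← hc_def]
    ring
  rw [hL1, hR1, condStep246_pair C Ω A hmsq hμ ha hL hj Λ' hG hGb Bn ψ, zCond252, zCond252, ← hc_def, heT, heTd, ← hcard,
    Real.rpow_def_of_pos hc, Real.rpow_def_of_pos hc, Real.rpow_def_of_pos hc, Real.rpow_def_of_pos hc,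
    Real.rpow_def_of_pos hc, Real.rpow_def_of_pos hc, mul_add, mul_add, mul_add, mul_add, Real.exp_add, Real.exp_add]
  ring

end Pair

end Literature.MathematicalPhysics.QuantumFieldTheory.Balaban1983to89.B2Eq246PairStep
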